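import Literature.Analysis.Complex.AffineHypersurfaceFibres
import HarnessLib

/-!
# Fibres of the projection of an affine hypersurface along a monic direction: clusters of roots

Layer `Literature/Analysis/Complex`, sequel of `AffineHypersurfaceFibres` (same setting: `P = Σ_j a_j(w) X^j`,
`a_j ∈ ℂ[w₁, …, w_m]`, `P.coeff d = c ≠ 0`, `deg a_j ≤ d - j`; fibre polynomials `P_w`). Near a parameter `w₀` the
roots of `P_w` cluster around the distinct roots `τ` of `P_{w₀}`:

* `exists_separation` — a radius `0 < ε ≤ min(1, η)` with `2ε <` all mutual distances of a finite set of points;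
* `exists_clusters` — for such an `ε`, on a ball around `w₀`: the tree's standing hypotheses `WeierstrassData` hold on
  every disc `|t - τ| < ε` (no roots on the circles), the disc around `τ` contains exactly `mult(τ)` roots of `P_w`
  counted with multiplicity (`WeierstrassData.exists_ball_card_eq`), and `P_w.roots = Σ_τ sliceRoots(τ, ε, w)` — every
  root of `P_w` lies within `ε` of a root of `P_{w₀}` (continuity of the roots as a multiset, Chirka §1.3, here from
  the constancy of the counts and `Σ_τ mult(τ) = d`).

Everything is proved; no definitions, no named facts.

## References

* E. M. Chirka, *Complex Analytic Sets* (1989), §1.3 (p. 7). [Chirka1989]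
* J.-P. Serre, *Géométrie algébrique et géométrie analytique*, Ann. Inst. Fourier 6 (1956), n° 19–20. [SerreGAGA1956]
-/

noncomputable section

open Polynomial Complex Metric Set Filter Finset
open scoped Topology

namespace Literature.Analysis.Complex

namespace AffineHypersurface

open SCV

variable {m : ℕ}

/-! ### Clusters of roots near a fibre -/

section Clusters

/-- A finite family of positive reals has a positive lower bound (also when the family is empty). [cite: Chirka1989, §1.3 (p. 7)] -/
theorem exists_pos_le_forall {ι : Type*} (S : Finset ι) (δ : ι → ℝ) (h : ∀ τ ∈ S, 0 < δ τ) :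
    ∃ δ₀ > 0, δ₀ ≤ 1 ∧ ∀ τ ∈ S, δ₀ ≤ δ τ := by
  classical
  induction S using Finset.induction_on with
  | empty => exact ⟨1, one_pos, le_rfl, fun τ hτ ↦ (Finset.notMem_empty τ hτ).elim⟩
  | insert a S ha ih =>
    obtain ⟨δ₀, hδ₀, hδ₁, hall⟩ := ih fun τ hτ ↦ h τ (mem_insert_of_mem hτ)
    refine ⟨min δ₀ (δ a), lt_min hδ₀ (h a (mem_insert_self a S)), (min_le_left _ _).trans hδ₁, fun τ hτ ↦ ?_⟩
    rcases mem_insert.mp hτ with rfl | hτ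
    · exact min_le_right _ _
    · exact (min_le_left _ _).trans (hall τ hτ)

/-- **A separating radius**: for a finite set of points of `ℂ` and `η > 0` there is `0 < ε ≤ min(1, η)` with
`2ε < dist τ τ'` for all distinct `τ, τ'` in the set. [cite: Chirka1989, §1.3 (p. 7)] -/
theorem exists_separation (S : Finset ℂ) {η : ℝ} (hη : 0 < η) :
    ∃ ε > 0, ε ≤ 1 ∧ ε ≤ η ∧ ∀ τ ∈ S, ∀ τ' ∈ S, τ ≠ τ' → 2 * ε < dist τ τ' := by
  classical
  obtain ⟨δ₀, hδ₀, hδ₁, hall⟩ := exists_pos_le_forall S.offDiag (fun p ↦ dist p.1 p.2) fun p hp ↦ by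
    rw [Finset.mem_offDiag] at hp
    exact dist_pos.mpr hp.2.2
  refine ⟨min (δ₀ / 3) η, lt_min (by positivity) hη, ?_, min_le_right _ _, fun τ hτ τ' hτ' hne ↦ ?_⟩
  · exact (min_le_left _ _).trans (by linarith)
  · have h := hall (τ, τ') (Finset.mem_offDiag.mpr ⟨hτ, hτ', hne⟩)
    have : 2 * min (δ₀ / 3) η ≤ 2 * (δ₀ / 3) := by gcongr; exact min_le_left _ _
    simp only at h
    linarith


variable {d : ℕ} {c : ℂ} (P : Polynomial (MvPolynomial (Fin m) ℂ))

/-- **The roots near a fibre split into clusters.** Let `τ` run over the distinct roots of `P_{w₀}` and let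
`ε > 0` be smaller than half their mutual distances. Then for `w` near `w₀`: the tree's standing hypotheses hold on
each disc `|t - τ| < ε` (no root on the circles `|t - τ| = ε`), the disc around `τ` contains exactly `mult(τ)` roots of
`P_w` counted with multiplicity, and the roots of `P_w` are exactly the roots in these discs:
`P_w.roots = Σ_τ sliceRoots(τ, ε, w)`. (Continuity of the roots as a multiset: Chirka §1.3; here from the constancy
of the number of zeros in each disc and the count `Σ_τ mult(τ) = d`.) [cite: Chirka1989, §1.3 (p. 7)] -/
theorem exists_clusters (hc : c ≠ 0) (hPd : P.natDegree ≤ d) (hPlead : P.coeff d = MvPolynomial.C c)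
    {L : ℝ} (hL : 1 ≤ L)
    (hroot : ∀ (w : Fin m → ℂ) (t : ℂ), (P.map (MvPolynomial.eval w)).IsRoot t → ‖t‖ ≤ L * (1 + ‖w‖))
    (w₀ : Fin m → ℂ) {ε : ℝ} (hε : 0 < ε) (hε1 : ε ≤ 1)
    (hsep : ∀ τ ∈ (P.map (MvPolynomial.eval w₀)).roots, ∀ τ' ∈ (P.map (MvPolynomial.eval w₀)).roots,
      τ ≠ τ' → 2 * ε < dist τ τ') :
    ∃ δ > 0, δ ≤ 1 ∧
      (∀ τ ∈ (P.map (MvPolynomial.eval w₀)).roots.toFinset,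
        WeierstrassData (fun x : (Fin m → ℂ) × ℂ ↦ (P.map (MvPolynomial.eval x.1)).eval x.2) (ball w₀ δ) τ ε
          (L * (2 + ‖w₀‖) + 2 - dist τ 0)) ∧
      (∀ τ ∈ (P.map (MvPolynomial.eval w₀)).roots.toFinset, ∀ w ∈ ball w₀ δ,
        Multiset.card (sliceRoots (fun x : (Fin m → ℂ) × ℂ ↦ (P.map (MvPolynomial.eval x.1)).eval x.2) τ ε w) =
          (P.map (MvPolynomial.eval w₀)).roots.count τ) ∧
      ∀ w ∈ ball w₀ δ, (P.map (MvPolynomial.eval w)).roots =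
        ∑ τ ∈ (P.map (MvPolynomial.eval w₀)).roots.toFinset,
          sliceRoots (fun x : (Fin m → ℂ) × ℂ ↦ (P.map (MvPolynomial.eval x.1)).eval x.2) τ ε w := by
  classical
  set f : (Fin m → ℂ) × ℂ → ℂ := fun x ↦ (P.map (MvPolynomial.eval x.1)).eval x.2 with hf
  set r₀ : ℝ := L * (2 + ‖w₀‖) + 1 with hr₀
  set S₀ := (P.map (MvPolynomial.eval w₀)).roots.toFinset with hS₀
  have hW := weierstrassData_fibre P hL hroot w₀
  have hw₀ : w₀ ∈ ball w₀ 1 := mem_ball_self one_pos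
  have hne0 := map_eval_ne_zero P hc hPlead
  -- roots of `P_{w₀}`: inside the big disc with margin, `ε`-circles root-free
  have hS₀root : ∀ τ ∈ S₀, (P.map (MvPolynomial.eval w₀)).IsRoot τ := fun τ hτ ↦
    (mem_roots (hne0 w₀)).mp (Multiset.mem_toFinset.mp hτ)
  have hτε : ∀ τ ∈ S₀, dist τ 0 + ε < r₀ := by
    intro τ hτ
    have h1 := hroot w₀ τ (hS₀root τ hτ)
    rw [dist_zero_right, hr₀]
    nlinarith [norm_nonneg w₀]
  have hcirc : ∀ τ ∈ S₀, ∀ t ∈ sphere τ ε, f (w₀, t) ≠ 0 := by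
    intro τ hτ t ht h0
    have htroot : t ∈ (P.map (MvPolynomial.eval w₀)).roots := (mem_roots (hne0 w₀)).mpr h0
    have hne : t ≠ τ := by
      intro h; rw [h, mem_sphere, dist_self] at ht; exact hε.ne' ht.symm
    have := hsep t htroot τ (Multiset.mem_toFinset.mp hτ) hne
    rw [mem_sphere] at ht
    linarith
  -- the small discs and the constancy of the counts
  have hsub : ∀ τ ∈ S₀, ∃ δ > 0, WeierstrassData f (ball w₀ δ) τ ε (L * (2 + ‖w₀‖) + 2 - dist τ 0) ∧
      ∀ w ∈ ball w₀ δ, Multiset.card (sliceRoots f τ ε w) = Multiset.card (sliceRoots f τ ε w₀) := by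
    intro τ hτ
    obtain ⟨δ₁, hδ₁, hδ₁U, hV⟩ := hW.exists_subdisc hw₀ hε (hτε τ hτ) (hcirc τ hτ)
    obtain ⟨δ₂, hδ₂, hδ₂V, hcard⟩ := hV.exists_ball_card_eq (mem_ball_self hδ₁)
    refine ⟨δ₂, hδ₂, ?_, hcard⟩
    have hδ₂1 : ball w₀ δ₂ ⊆ ball w₀ δ₁ := hδ₂V
    exact hV.mono isOpen_ball hδ₂1
  choose! δτ hδτ hVτ hcardτ using hsub
  obtain ⟨δ, hδ, hδ1, hδle⟩ := exists_pos_le_forall S₀ δτ hδτ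
  have hballδ : ∀ τ ∈ S₀, ball w₀ δ ⊆ ball w₀ (δτ τ) := fun τ hτ ↦ ball_subset_ball (hδle τ hτ)
  have hVδ : ∀ τ ∈ S₀, WeierstrassData f (ball w₀ δ) τ ε (L * (2 + ‖w₀‖) + 2 - dist τ 0) := fun τ hτ ↦
    (hVτ τ hτ).mono isOpen_ball (hballδ τ hτ)
  -- the count in the disc around `τ` at `w₀` is the multiplicity of `τ`
  have hcount₀ : ∀ τ ∈ S₀, sliceRoots f τ ε w₀ = (P.map (MvPolynomial.eval w₀)).roots.count τ • {τ} := by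
    intro τ hτ
    have hV := hVτ τ hτ
    have hw₀' : w₀ ∈ ball w₀ (δτ τ) := mem_ball_self (hδτ τ hτ)
    ext ρ
    rw [Multiset.count_nsmul, Multiset.count_singleton]
    by_cases hρ : ρ ∈ ball τ ε
    · rw [sliceRoots, count_rootMultiset_of_mem_ball (hV.differentiableOn_slice hw₀') hV.pos hV.lt
        (hV.ne_zero w₀ hw₀') hρ, analyticOrderNatAt]
      change (analyticOrderAt (fun t ↦ (P.map (MvPolynomial.eval w₀)).eval t) ρ).toNat = _
      rw [analyticOrderAt_fibre P hc hPd hPlead w₀ ρ, ENat.toNat_coe]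
      split_ifs with hρτ
      · rw [hρτ, mul_one]
      · rw [mul_zero, Multiset.count_eq_zero]
        intro hρroot
        have := hsep ρ hρroot τ (Multiset.mem_toFinset.mp hτ) hρτ
        rw [mem_ball] at hρ
        linarith
    · have hnot : ρ ∉ sliceRoots f τ ε w₀ := fun h ↦ hρ (mem_ball_of_mem_rootMultiset h)
      rw [Multiset.count_eq_zero_of_notMem hnot]
      split_ifs with hρτ
      · exact absurd (hρτ ▸ mem_ball_self hε) hρ
      · rw [mul_zero]
  have hcard : ∀ τ ∈ S₀, ∀ w ∈ ball w₀ δ,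
      Multiset.card (sliceRoots f τ ε w) = (P.map (MvPolynomial.eval w₀)).roots.count τ := by
    intro τ hτ w hw
    rw [hcardτ τ hτ w (hballδ τ hτ hw), hcount₀ τ hτ, Multiset.card_nsmul, Multiset.card_singleton, mul_one]
  refine ⟨δ, hδ, hδ1, hVδ, hcard, fun w hw ↦ ?_⟩
  -- the splitting of the roots of `P_w`
  have hw1 : w ∈ ball w₀ 1 := ball_subset_ball hδ1 hw
  set M := (P.map (MvPolynomial.eval w)).roots with hM
  have hMeq : sliceRoots f 0 r₀ w = M := sliceRoots_fibre_eq_roots P hc hPd hPlead hL hroot hw1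
  have hfilter : ∀ τ ∈ S₀, sliceRoots f τ ε w = M.filter (· ∈ ball τ ε) := by
    intro τ hτ
    rw [← hMeq]
    refine (hW.filter_sliceRoots_eq (hVδ τ hτ) (ball_subset_ball hδ1) (fun t ht ↦ ?_) hw).symm
    rw [mem_ball] at ht ⊢
    have := hτε τ hτ
    calc dist t 0 ≤ dist t τ + dist τ 0 := dist_triangle _ _ _
      _ < r₀ := by linarith
  -- `Σ_τ sliceRoots ≤ M` since the discs are disjoint
  have hdisj : ∀ ρ, ∀ τ ∈ S₀, ∀ τ' ∈ S₀, ρ ∈ ball τ ε → ρ ∈ ball τ' ε → τ = τ' := by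
    intro ρ τ hτ τ' hτ' h1 h2
    by_contra hne
    have := hsep τ (Multiset.mem_toFinset.mp hτ) τ' (Multiset.mem_toFinset.mp hτ') hne
    rw [mem_ball] at h1 h2
    have := dist_triangle_left τ τ' ρ
    linarith
  have hle : ∑ τ ∈ S₀, sliceRoots f τ ε w ≤ M := by
    rw [Multiset.le_iff_count]
    intro ρ
    rw [Multiset.count_sum']
    by_cases hρ : ∃ τ ∈ S₀, ρ ∈ ball τ ε
    · obtain ⟨τ, hτ, hρτ⟩ := hρ
      rw [Finset.sum_eq_single τ]
      · rw [hfilter τ hτ, Multiset.count_filter, if_pos hρτ]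
      · intro τ' hτ' hne
        rw [hfilter τ' hτ', Multiset.count_filter, if_neg]
        exact fun h ↦ hne (hdisj ρ τ' hτ' τ hτ h hρτ)
      · exact fun h ↦ absurd hτ h
    · push Not at hρ
      rw [Finset.sum_eq_zero fun τ hτ ↦ ?_]
      · exact Nat.zero_le _
      rw [hfilter τ hτ, Multiset.count_filter, if_neg (hρ τ hτ)]
  have hcardsum : Multiset.card (∑ τ ∈ S₀, sliceRoots f τ ε w) = Multiset.card M := by
    rw [Multiset.card_sum, Finset.sum_congr rfl fun τ hτ ↦ hcard τ hτ w hw, hS₀, Multiset.toFinset_sum_count_eq,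
      hM, card_roots_map_eval P hc hPd hPlead, card_roots_map_eval P hc hPd hPlead]
  exact (Multiset.eq_of_le_of_card_le hle hcardsum.ge).symm


/-- **Cluster package with local holomorphic extensions.** Let `g` be a function on the hypersurface
`U = {(w, t) | P_w(t) = 0}` which is locally the restriction of holomorphic functions of `ℂ^m × ℂ`. Then around every
`w₀` there are a radius `0 < ε ≤ 1`, a ball `B = ball w₀ δ` (`δ ≤ 1`) and, for every distinct root `τ` of `P_{w₀}`, a
function `G_τ` holomorphic on `B × {|t - τ| < 2ε}` agreeing with `g` on `U` there, such that on `B`: the standing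
hypotheses `WeierstrassData` hold on the discs `|t - τ| < ε` (with outer radius `2ε`), the disc around `τ` carries
`mult(τ)` roots of `P_w`, the distinct roots of `P_{w₀}` are `> 2ε` apart, and `P_w.roots = Σ_τ sliceRoots(τ, ε, w)`.
[cite: Chirka1989, §1.3 (p. 7)] -/
theorem exists_cluster_package (hc : c ≠ 0) (hPd : P.natDegree ≤ d) (hPlead : P.coeff d = MvPolynomial.C c)
    {L : ℝ} (hL : 1 ≤ L)
    (hroot : ∀ (w : Fin m → ℂ) (t : ℂ), (P.map (MvPolynomial.eval w)).IsRoot t → ‖t‖ ≤ L * (1 + ‖w‖))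
    {g : (Fin m → ℂ) × ℂ → ℂ}
    (hhol : ∀ x : (Fin m → ℂ) × ℂ, (P.map (MvPolynomial.eval x.1)).eval x.2 = 0 →
      ∃ W : Set ((Fin m → ℂ) × ℂ), IsOpen W ∧ x ∈ W ∧ ∃ G : (Fin m → ℂ) × ℂ → ℂ, DifferentiableOn ℂ G W ∧
        ∀ y ∈ W, (P.map (MvPolynomial.eval y.1)).eval y.2 = 0 → G y = g y)
    (w₀ : Fin m → ℂ) :
    ∃ ε > 0, ε ≤ 1 ∧ ∃ δ > 0, δ ≤ 1 ∧ ∃ G : ℂ → (Fin m → ℂ) × ℂ → ℂ,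
      (∀ τ ∈ (P.map (MvPolynomial.eval w₀)).roots, ∀ τ' ∈ (P.map (MvPolynomial.eval w₀)).roots,
        τ ≠ τ' → 2 * ε < dist τ τ') ∧
      (∀ τ ∈ (P.map (MvPolynomial.eval w₀)).roots.toFinset,
        WeierstrassData (fun x : (Fin m → ℂ) × ℂ ↦ (P.map (MvPolynomial.eval x.1)).eval x.2) (ball w₀ δ) τ ε (2 * ε)) ∧
      (∀ τ ∈ (P.map (MvPolynomial.eval w₀)).roots.toFinset, DifferentiableOn ℂ (G τ) (ball w₀ δ ×ˢ ball τ (2 * ε))) ∧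
      (∀ τ ∈ (P.map (MvPolynomial.eval w₀)).roots.toFinset, ∀ x ∈ ball w₀ δ ×ˢ ball τ (2 * ε),
        (P.map (MvPolynomial.eval x.1)).eval x.2 = 0 → G τ x = g x) ∧
      (∀ τ ∈ (P.map (MvPolynomial.eval w₀)).roots.toFinset, ∀ w ∈ ball w₀ δ,
        Multiset.card (sliceRoots (fun x : (Fin m → ℂ) × ℂ ↦ (P.map (MvPolynomial.eval x.1)).eval x.2) τ ε w) =
          (P.map (MvPolynomial.eval w₀)).roots.count τ) ∧
      ∀ w ∈ ball w₀ δ, (P.map (MvPolynomial.eval w)).roots =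
        ∑ τ ∈ (P.map (MvPolynomial.eval w₀)).roots.toFinset,
          sliceRoots (fun x : (Fin m → ℂ) × ℂ ↦ (P.map (MvPolynomial.eval x.1)).eval x.2) τ ε w := by
  classical
  set f : (Fin m → ℂ) × ℂ → ℂ := fun x ↦ (P.map (MvPolynomial.eval x.1)).eval x.2 with hf
  set S₀ := (P.map (MvPolynomial.eval w₀)).roots.toFinset with hS₀
  have hne0 := map_eval_ne_zero P hc hPlead
  -- local extensions at the roots of `P_{w₀}`, on product balls of radius `η τ`
  have hext : ∀ τ ∈ S₀, ∃ η > 0, ∃ G : (Fin m → ℂ) × ℂ → ℂ, DifferentiableOn ℂ G (ball w₀ η ×ˢ ball τ η) ∧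
      ∀ x ∈ ball w₀ η ×ˢ ball τ η, f x = 0 → G x = g x := by
    intro τ hτ
    have hτ0 : f (w₀, τ) = 0 := (mem_roots (hne0 w₀)).mp (Multiset.mem_toFinset.mp hτ)
    obtain ⟨W, hWo, hxW, G, hG, hGg⟩ := hhol (w₀, τ) hτ0
    obtain ⟨η, hη, hηW⟩ := Metric.isOpen_iff.mp hWo (w₀, τ) hxW
    refine ⟨η, hη, G, hG.mono (fun x hx ↦ hηW ?_), fun x hx hx0 ↦ hGg x (hηW ?_) hx0⟩ <;>
    · rw [← ball_prod_same]; exact hx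
  choose! η hη G hG hGg using hext
  obtain ⟨η₀, hη₀, -, hη₀le⟩ := exists_pos_le_forall S₀ η hη
  -- a separating radius `ε ≤ η₀ / 2`
  obtain ⟨ε, hε, hε1, hεη, hsep⟩ := exists_separation S₀ (half_pos hη₀)
  have hsep' : ∀ τ ∈ (P.map (MvPolynomial.eval w₀)).roots, ∀ τ' ∈ (P.map (MvPolynomial.eval w₀)).roots,
      τ ≠ τ' → 2 * ε < dist τ τ' := fun τ hτ τ' hτ' hne ↦
    hsep τ (Multiset.mem_toFinset.mpr hτ) τ' (Multiset.mem_toFinset.mpr hτ') hne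
  obtain ⟨δ, hδ, hδ1, hV, hcard, hsplit⟩ := exists_clusters P hc hPd hPlead hL hroot w₀ hε hε1 hsep'
  -- shrink the ball in `w` below `η₀`
  set δ' := min δ η₀ with hδ'
  have hδ'δ : ball w₀ δ' ⊆ ball w₀ δ := ball_subset_ball (min_le_left _ _)
  have hδ'η : ∀ τ ∈ S₀, ball w₀ δ' ⊆ ball w₀ (η τ) := fun τ hτ ↦
    ball_subset_ball ((min_le_right _ _).trans (hη₀le τ hτ))
  have h2ε : ∀ τ ∈ S₀, ball τ (2 * ε) ⊆ ball τ (η τ) := fun τ hτ ↦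
    ball_subset_ball (by linarith [hη₀le τ hτ])
  refine ⟨ε, hε, hε1, δ', lt_min hδ hη₀, (min_le_left _ _).trans hδ1, G, hsep', fun τ hτ ↦ ?_, fun τ hτ ↦ ?_,
    fun τ hτ x hx hx0 ↦ ?_, fun τ hτ w hw ↦ hcard τ hτ w (hδ'δ hw), fun w hw ↦ hsplit w (hδ'δ hw)⟩
  · exact
      { isOpen := isOpen_ball
        pos := hε
        lt := by linarith
        differentiableOn := (differentiable_fibre P).differentiableOn
        ne_zero := fun w hw t ht ↦ (hV τ hτ).ne_zero w (hδ'δ hw) t ht }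
  · exact (hG τ hτ).mono (prod_mono (hδ'η τ hτ) (h2ε τ hτ))
  · exact hGg τ hτ x (prod_mono (hδ'η τ hτ) (h2ε τ hτ) hx) hx0

end Clusters

end AffineHypersurface

end Literature.Analysis.Complex
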